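/-
Copyright: the b2b-balaban T⁴-continuum CRUX team, row NE7b leaf lineage `t4-ne7b-formalise-leaf-01` (gen 85). Project licence.
-/
import Summits.QuantumFields.BalabanUV.T4Continuum.Spine.NE7b.TwoScalePoincareBlocking

/-!
# THE CUBE OF SIDE `n` IN EVERY DIMENSION `d` HAS THE PATH's POINCARÉ CONSTANT `n(n − 1)` — the `d`-fold iteration of
# `…TwoScalePoincareBlocking`'s tensorisation step as ONE theorem over `Fin d → Fin n`, and the two-scale constant of the hard-step
# tower's model letter BY VALUE in dimension `d = 4`: `m₂ = (L²(L² − 1))⁻¹` for the cube of side `L²` (row NE7b, node U5c; [folklore])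

Cell `pub-balaban`, sub-cell `t4`, spine estimate NE7b (`T4WeightBudget.RelWeightBound`; the cell's OWN estimate — NOT PRINTED in
[Bałaban 1983–89], NOT PROVED).  Crux-route work under `Spine/NE7b/` by a row leaf (`t4-ne7b-formalise-leaf-01` gen 85) under FREEZE (0)'s
crux-prover clause; NOTHING of Bałaban's is named as a Lean object, valued or asserted; no `T4Continuum/Support` leaf typed; no `def`;
zero `sorry`.  Imports: this lineage's `…TwoScalePoincareBlocking` (TSPB) only.

WHY.  TSPB §2 `productPoincare_mean` is the tensorisation STEP (rows over any finite fibre, no dimension factor) and §2b instantiates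
`d = 2`; its NOT-HERE lists «the `d`-fold iteration of §2 as one statement over `Fin d → Fin n`».  THIS FILE is that statement: by
induction on `d`, with the fibre `Fin d → Fin n` and TSPB's step at each level, the cube `Fin d → Fin n` with the nearest-neighbour
Dirichlet form `E_d(u) = Σ_{a<d} Σ_x (u(x + e_a) − u(x))²` (links inside the cube only) satisfies
`Σ_x (u x − ū)² ≤ n(n − 1)·E_d(u)` for EVERY `d` — the constant is the PATH's, independent of the dimension.  Consequence for the
hard-step tower's model letter (TSPB §4): the two-scale Poincaré constant of the cube of side `L²` is `(L²(L² − 1))⁻¹` in dimension 4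
(and in every dimension), so `t²·m₂∕d_T² = (L² − 1)⁻¹` is valued for the row's `d = 4`, not only for `d ≤ 2`.

WHAT IS PROVED ([folklore]):
* §1 `sum_cube_succ` (`Σ_{x : Fin (d+1) → Fin n} F x = Σ_i Σ_{a : Fin d → Fin n} F (Fin.cons i a)`), `card_cube_succ`.
* §2 **`cubePoincare_mean`** — for `0 < n`, every `d` and every `u : (Fin d → Fin n) → ℝ`:
  `Σ_x (u x − (Σ u)∕n^d)² ≤ n(n − 1)·Σ_{a : Fin d} Σ_x [x_a + 1 < n] (u (update x a (x_a + 1)) − u x)²`; `cubePoincare` (zero-sum form).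
* §3 `cubePoincare_four` — the row's dimension: `d = 4`, side `n`, constant `n(n − 1)`; with `n = L²` this is TSPB's `m₂⁻¹ = L²(L² − 1)`.

NOT HERE (honest): the sharp constant; periodic (torus) links — the cube's OWN links suffice for the two-scale letter (TSPB §3
`twoScale_of_blockPoincare` needs only `Σ_blocks E_block ≤ E`); which form print has ((A3) ∕ (A1c), NC-NE7b-α UNRULED).  BY-NAME EFFECT ON
THE WALL: NONE.  NE7b NOT PRINTED ∕ NOT PROVED; spine PROVED 0∕9; rung (B)+1 on a FINITE torus — NOT infinite volume, NOT the mass gap,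
NOT Clay.  HONEST DEPENDENCY: continuum YM on T⁴ ⇐ BetaPertH ∧ nine spine estimates (0∕9 proved); BetaPertH ⇐ (D1) ∧ (D4) ∧ CAP+tail;
G-an2-4 gates asym, D1 and NE2∕3∕4.
-/

set_option autoImplicit false

open Finset

namespace Summit.QuantumFields.BalabanUV.T4Continuum.NE7b.CubePoincareTensorised

open Summit.QuantumFields.BalabanUV.T4Continuum.NE7b.TwoScalePoincareBlocking (productPoincare_mean)

/-! ## §1. Splitting a `(d+1)`-cube into rows of `d`-cubes -/

/-- `Σ_{x : Fin (d+1) → Fin n} F x = Σ_{i : Fin n} Σ_{a : Fin d → Fin n} F (Fin.cons i a)`. [folklore] -/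
theorem sum_cube_succ {n d : ℕ} (F : (Fin (d + 1) → Fin n) → ℝ) :
    ∑ x, F x = ∑ i : Fin n, ∑ a : Fin d → Fin n, F (Fin.cons i a) := by
  rw [← (Fin.consEquiv fun _ : Fin (d + 1) => Fin n).sum_comp, Fintype.sum_prod_type]
  rfl

/-- `card (Fin (d+1) → Fin n) = n · card (Fin d → Fin n)` (as reals). [folklore] -/
theorem card_cube_succ (n d : ℕ) : (Fintype.card (Fin (d + 1) → Fin n) : ℝ) = n * Fintype.card (Fin d → Fin n) := by
  simp only [Fintype.card_fun, Fintype.card_fin, pow_succ]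
  push_cast
  ring

/-! ## §2. The cube Poincaré letter in every dimension -/

/-- **THE CUBE OF SIDE `n` IN DIMENSION `d` HAS POINCARÉ CONSTANT `n(n − 1)`, FOR EVERY `d`** (`0 < n`): for `u : (Fin d → Fin n) → ℝ`,
`Σ_x (u x − ū)² ≤ n(n − 1)·Σ_{a<d} Σ_x [x_a + 1 < n]·(u(x + e_a) − u x)²`.  Induction on `d`: the `0`-cube is a point (variance `0`); the
`(d+1)`-cube is `n` rows of `d`-cubes, TSPB's `productPoincare_mean` with the `d`-cube's letter as the fibre's, the `a = 0` links as the
vertical ones and the `a = b.succ` links as the rows' own. [folklore] -/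
theorem cubePoincare_mean {n : ℕ} (hn : 0 < n) : ∀ (d : ℕ) (u : (Fin d → Fin n) → ℝ),
    ∑ x, (u x - (∑ y, u y) / Fintype.card (Fin d → Fin n)) ^ 2 ≤
      (n : ℝ) * (n - 1) * ∑ a : Fin d, ∑ x : Fin d → Fin n,
        (if h : (x a : ℕ) + 1 < n then (u (Function.update x a ⟨(x a : ℕ) + 1, h⟩) - u x) ^ 2 else 0)
  | 0, u => by simp [Fintype.card_unique]
  | d + 1, u => by
    have IH := cubePoincare_mean hn d
    have hcard : 0 < Fintype.card (Fin d → Fin n) := Fintype.card_pos_iff.mpr ⟨fun _ => ⟨0, hn⟩⟩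
    -- the rows, read on `ℕ`
    set U : ℕ → (Fin d → Fin n) → ℝ := fun i a => if h : i < n then u (Fin.cons ⟨i, h⟩ a) else 0 with hUdef
    have hU : ∀ (i : Fin n) (a : Fin d → Fin n), U i a = u (Fin.cons i a) := fun i a => by
      simp [hUdef, i.isLt]
    -- TSPB's product step with the `d`-cube letter on the fibre
    have step := productPoincare_mean (α := Fin d → Fin n) hcard
      (Eα := fun w => ∑ a : Fin d, ∑ x : Fin d → Fin n,
        (if h : (x a : ℕ) + 1 < n then (w (Function.update x a ⟨(x a : ℕ) + 1, h⟩) - w x) ^ 2 else 0))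
      (cα := (n : ℝ) * (n - 1)) (fun w => IH w) U hn
    -- LEFT: the variance of `u` is the rows' variance
    have hsum : ∑ y, u y = ∑ j ∈ range n, ∑ b, U j b := by
      rw [sum_cube_succ, Finset.sum_fin_eq_sum_range]
      refine sum_congr rfl fun j hj => ?_
      rw [dif_pos (mem_range.1 hj)]
      exact Fintype.sum_congr _ _ fun b => (hU _ b).symm
    have hlhs : ∑ x, (u x - (∑ y, u y) / Fintype.card (Fin (d + 1) → Fin n)) ^ 2 =
        ∑ i ∈ range n, ∑ a, (U i a - (∑ j ∈ range n, ∑ b, U j b) / (n * Fintype.card (Fin d → Fin n))) ^ 2 := by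
      rw [card_cube_succ, hsum, sum_cube_succ, Finset.sum_fin_eq_sum_range]
      refine sum_congr rfl fun i hi => ?_
      have hi' : i < n := mem_range.1 hi
      rw [dif_pos hi']
      exact Fintype.sum_congr _ _ fun a => by simp only [hUdef, hi', dif_pos]
    -- RIGHT, direction `0`: the vertical links between consecutive rows
    have hvert : ∑ x : Fin (d + 1) → Fin n,
        (if h : (x 0 : ℕ) + 1 < n then (u (Function.update x 0 ⟨(x 0 : ℕ) + 1, h⟩) - u x) ^ 2 else 0) =
        ∑ i ∈ range (n - 1), ∑ a, (U (i + 1) a - U i a) ^ 2 := by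
      rw [sum_cube_succ]
      simp only [Fin.cons_zero, Fin.update_cons_zero]
      obtain ⟨m, rfl⟩ : ∃ m, n = m + 1 := ⟨n - 1, by omega⟩
      rw [Nat.add_sub_cancel, Fin.sum_univ_castSucc]
      have hlast : ∑ a : Fin d → Fin (m + 1),
          (if h : ((Fin.last m : Fin (m + 1)) : ℕ) + 1 < m + 1 then
            (u (Fin.cons ⟨((Fin.last m : Fin (m + 1)) : ℕ) + 1, h⟩ a) - u (Fin.cons (Fin.last m) a)) ^ 2 else 0) = 0 := by
        refine sum_eq_zero fun a _ => ?_
        rw [dif_neg]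
        simp
      rw [hlast, add_zero, ← Fin.sum_univ_eq_sum_range (fun i => ∑ a, (U (i + 1) a - U i a) ^ 2) m]
      refine Fintype.sum_congr _ _ fun i => ?_
      have hi1 : (i : ℕ) + 1 < m + 1 := by omega
      have hi0 : (i : ℕ) < m + 1 := by omega
      simp only [Fin.val_castSucc, hi1, dif_pos]
      refine Fintype.sum_congr _ _ fun a => ?_
      simp only [hUdef, hi1, hi0, dif_pos]
      rfl
    -- RIGHT, directions `b.succ`: the rows' own links
    have hrow : ∀ b : Fin d, ∑ x : Fin (d + 1) → Fin n,
        (if h : (x b.succ : ℕ) + 1 < n then (u (Function.update x b.succ ⟨(x b.succ : ℕ) + 1, h⟩) - u x) ^ 2 else 0) =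
        ∑ i ∈ range n, ∑ a' : Fin d → Fin n,
          (if h : (a' b : ℕ) + 1 < n then (U i (Function.update a' b ⟨(a' b : ℕ) + 1, h⟩) - U i a') ^ 2 else 0) := by
      intro b
      rw [sum_cube_succ]
      simp only [Fin.cons_succ, ← Fin.cons_update]
      rw [Finset.sum_fin_eq_sum_range]
      refine sum_congr rfl fun i hi => ?_
      have hi' : i < n := mem_range.1 hi
      rw [dif_pos hi']
      refine Fintype.sum_congr _ _ fun a' => ?_
      simp only [hUdef, hi', dif_pos]
    -- assemble
    have hcomm : ∑ b : Fin d, ∑ i ∈ range n, ∑ a' : Fin d → Fin n,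
          (if h : (a' b : ℕ) + 1 < n then (U i (Function.update a' b ⟨(a' b : ℕ) + 1, h⟩) - U i a') ^ 2 else 0) =
        ∑ i ∈ range n, ∑ b : Fin d, ∑ a' : Fin d → Fin n,
          (if h : (a' b : ℕ) + 1 < n then (U i (Function.update a' b ⟨(a' b : ℕ) + 1, h⟩) - U i a') ^ 2 else 0) :=
      Finset.sum_comm
    rw [hlhs, Fin.sum_univ_succ, hvert, Fintype.sum_congr _ _ hrow, hcomm]
    calc ∑ i ∈ range n, ∑ a, (U i a - (∑ j ∈ range n, ∑ b, U j b) / (n * Fintype.card (Fin d → Fin n))) ^ 2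
        ≤ (n : ℝ) * (n - 1) * ∑ i ∈ range n, (∑ a : Fin d, ∑ x : Fin d → Fin n,
            (if h : (x a : ℕ) + 1 < n then (U i (Function.update x a ⟨(x a : ℕ) + 1, h⟩) - U i x) ^ 2 else 0)) +
          (n : ℝ) * (n - 1) * ∑ i ∈ range (n - 1), ∑ a, (U (i + 1) a - U i a) ^ 2 := step
      _ = (n : ℝ) * (n - 1) * (∑ i ∈ range (n - 1), ∑ a, (U (i + 1) a - U i a) ^ 2 +
          ∑ i ∈ range n, ∑ a : Fin d, ∑ x : Fin d → Fin n,
            (if h : (x a : ℕ) + 1 < n then (U i (Function.update x a ⟨(x a : ℕ) + 1, h⟩) - U i x) ^ 2 else 0)) := by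
          ring

/-- Zero-sum form: `Σ u = 0 ⟹ Σ_x (u x)² ≤ n(n − 1)·E_d(u)`. [folklore] -/
theorem cubePoincare {n : ℕ} (hn : 0 < n) (d : ℕ) (u : (Fin d → Fin n) → ℝ) (h0 : ∑ y, u y = 0) :
    ∑ x, u x ^ 2 ≤ (n : ℝ) * (n - 1) * ∑ a : Fin d, ∑ x : Fin d → Fin n,
        (if h : (x a : ℕ) + 1 < n then (u (Function.update x a ⟨(x a : ℕ) + 1, h⟩) - u x) ^ 2 else 0) := by
  have h := cubePoincare_mean hn d u
  simp only [h0, zero_div, sub_zero] at h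
  exact h

/-! ## §3. The row's dimension -/

/-- **`d = 4`**: the hypercube of side `n` has Poincaré constant `n(n − 1)`; with `n = L²` this is the two-scale constant
`m₂ = (L²(L² − 1))⁻¹` of TSPB's `closing_by_value` for the four-dimensional blocking. [folklore] -/
theorem cubePoincare_four {n : ℕ} (hn : 0 < n) (u : (Fin 4 → Fin n) → ℝ) (h0 : ∑ y, u y = 0) :
    ∑ x, u x ^ 2 ≤ (n : ℝ) * (n - 1) * ∑ a : Fin 4, ∑ x : Fin 4 → Fin n,
        (if h : (x a : ℕ) + 1 < n then (u (Function.update x a ⟨(x a : ℕ) + 1, h⟩) - u x) ^ 2 else 0) :=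
  cubePoincare hn 4 u h0

end Summit.QuantumFields.BalabanUV.T4Continuum.NE7b.CubePoincareTensorised
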